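import Summits.KontsevichZagierPeriods.KontsevichZagierPeriods.Theorems.RootDecompWalshStrataHtypeFrames

/-!
# Root decomposition (Walsh strata), part 51 — H-type fibre discriminants V: line edges reparametrised by `x`

The residual family `R-HL` of part 48 consists of the sections of the vertex chart lying over a LINE edge
`y = λ(x) = κ₀ + κ₁ x` of an H-type cell (`D = H(x) − m y²`, `H = e x² + g`, `e > 0`, `m ≥ 1`).  Such a section is
pulled back along the edge to the `x`-line (`VertexChart.edge_pullback`, rules (2)–(3)): with
`t_b = √D(x, λ(x)) = √(H − m λ²)` the chart integrand `γ·Hi(ζ)·g_m(v)` becomes the `m`-free algebraic one-form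

  `γ · Hi(x) · √(H(x) − m λ(x)²) · |N(x)| / (2 H(x)²) dx`,   `N = 2Hλ′ − λH′ = 2(κ₁ g − e κ₀ x)`,

on a semialgebraic subset of `[0, 1]`.  The strict monotonicity of the ratio `λ/√H` on each side of the zero of
the linear form `N/2` (51.1) supplies the injectivity the change of variables needs (51.2, the pullback of
a signed piece, `InBaker.of_Hline_piece`).  The assembly `R-HL ⟸ R-HLx` (`InBaker.of_Hlines`) is part 51b
(`RootDecompWalshStrataHtypeLineSections`).

References: [KontsevichZagier2001 §1.2 rules (1)–(3)], [BCR1998 §2.2].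
-/

noncomputable section

open Set MeasureTheory MvPolynomial Literature.NumberTheory.Transcendental
open Literature.ModelTheory.ExponentialFields (IsSemialgebraic isSemialgebraic_univ isSemialgebraic_empty)
open Summit.KontsevichZagierPeriods.RootDecompWalshStrata.ConicDescent.VertexChart

namespace Summit.KontsevichZagierPeriods.RootDecompWalshStrata.ConicDescent.BallCube

/-! #### 51.1 The line ordinate, the ratio `λ/√H` and its monotonicity -/

/-- The line ordinate `λ(x) = κ₀ + κ₁ x`. -/
def hLam (κ₀ κ₁ : ℚ) (x : ℝ) : ℝ := (κ₀ : ℝ) + κ₁ * x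

/-- Half the edge numerator `N/2 = κ₁ g − e κ₀ x` (`N = 2Hλ′ − λH′`). -/
def hNum (e g κ₀ κ₁ : ℚ) (x : ℝ) : ℝ := (κ₁ : ℝ) * g - e * κ₀ * x

/-- The chart ratio `λ(x)/√H(x)` along the line (`= U_m(v)` on the section). -/
def hRat (e g κ₀ κ₁ : ℚ) (x : ℝ) : ℝ := hLam κ₀ κ₁ x / vS (hP e g) x

variable {e g m κ₀ κ₁ : ℚ}

/-- `H′(x) = 2 e x`. [bookkeeping] -/
theorem aeval_derivative_hP (e g : ℚ) (x : ℝ) :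
    Polynomial.aeval x (Polynomial.derivative (hP e g)) = 2 * (e : ℝ) * x := by
  simp only [hP, Polynomial.derivative_add, Polynomial.derivative_C_mul_X_pow, Polynomial.derivative_C,
    add_zero, map_mul, Polynomial.aeval_C, map_pow, Polynomial.aeval_X, eq_ratCast]
  push_cast
  ring

/-- `λ′ = κ₁`. [calculus] -/
theorem hasDerivAt_hLam (κ₀ κ₁ : ℚ) (x : ℝ) : HasDerivAt (hLam κ₀ κ₁) (κ₁ : ℝ) x := by
  have h : HasDerivAt (fun x : ℝ => (κ₀ : ℝ) + κ₁ * x) ((κ₁ : ℝ) * 1) x :=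
    ((hasDerivAt_id x).const_mul (κ₁ : ℝ)).const_add (κ₀ : ℝ)
  rw [mul_one] at h
  exact h

/-- `(λ/√H)′ = (N/2)/(H·√H)` where `H > 0`. [calculus] -/
theorem hasDerivAt_hRat {x : ℝ} (hx : 0 < Polynomial.aeval x (hP e g)) :
    HasDerivAt (hRat e g κ₀ κ₁) (hNum e g κ₀ κ₁ x / (Polynomial.aeval x (hP e g) * vS (hP e g) x)) x := by
  have h := hasDerivAt_ratio (Y₀ := 0) (H := hP e g) (hasDerivAt_hLam κ₀ κ₁ x) hx
  simp only [map_zero, sub_zero] at h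
  have hS := vS_pos hx
  have hS2 : vS (hP e g) x ^ 2 = Polynomial.aeval x (hP e g) := vS_sq hx.le
  have hfun : (fun s => hLam κ₀ κ₁ s / vS (hP e g) s) = hRat e g κ₀ κ₁ := rfl
  rw [hfun] at h
  have hg' : (g : ℝ) = vS (hP e g) x ^ 2 - e * x ^ 2 := by rw [hS2, aeval_hP]; ring
  convert h using 1
  rw [aeval_derivative_hP, ← hS2]
  unfold hNum hLam
  rw [hg']
  field_simp
  ring

/-- `λ/√H` is continuous where `H > 0`. [calculus] -/
theorem continuousOn_hRat {D : Set ℝ} (hD : ∀ x ∈ D, 0 < Polynomial.aeval x (hP e g)) :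
    ContinuousOn (hRat e g κ₀ κ₁) D := by
  have h1 : Continuous (hLam κ₀ κ₁) := by unfold hLam; fun_prop
  exact h1.continuousOn.div (continuous_vS (hP e g)).continuousOn fun x hx => (vS_pos (hD x hx)).ne'

/-- The sign set `D_ς = {x ≥ 0 | H(x) > 0, ς·N(x)/2 > 0}` is order-connected (`e > 0`). [bookkeeping] -/
theorem ordConnected_hSignSet (he : 0 < e) (g κ₀ κ₁ ς : ℚ) :
    OrdConnected {x : ℝ | 0 ≤ x ∧ 0 < Polynomial.aeval x (hP e g) ∧ 0 < (ς : ℝ) * hNum e g κ₀ κ₁ x} := by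
  refine ⟨fun x hx y hy z hz => ?_⟩
  obtain ⟨hx0, hxH, hxN⟩ := hx
  obtain ⟨hy0, hyH, hyN⟩ := hy
  obtain ⟨hxz, hzy⟩ := hz
  have he' : (0 : ℝ) < e := by exact_mod_cast he
  rw [aeval_hP] at hxH hyH
  refine ⟨hx0.trans hxz, ?_, ?_⟩
  · rw [aeval_hP]
    have : x ^ 2 ≤ z ^ 2 := pow_le_pow_left₀ hx0 hxz 2
    nlinarith
  · unfold hNum at hxN hyN ⊢
    rcases le_total 0 ((ς : ℝ) * (e * κ₀)) with h | h
    · have : (ς : ℝ) * (e * κ₀) * (y - z) ≥ 0 := mul_nonneg h (by linarith)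
      nlinarith
    · have : (ς : ℝ) * (e * κ₀) * (z - x) ≤ 0 := mul_nonpos_of_nonpos_of_nonneg h (by linarith)
      nlinarith

/-- `λ/√H` is injective on each sign set `D_ς` (`ς·λ/√H` is strictly increasing there, its derivative being
`ς(N/2)/(H√H) > 0`). [calculus] -/
theorem hRat_injOn (he : 0 < e) {ς : ℚ} :
    InjOn (hRat e g κ₀ κ₁)
      {x : ℝ | 0 ≤ x ∧ 0 < Polynomial.aeval x (hP e g) ∧ 0 < (ς : ℝ) * hNum e g κ₀ κ₁ x} := by
  set D := {x : ℝ | 0 ≤ x ∧ 0 < Polynomial.aeval x (hP e g) ∧ 0 < (ς : ℝ) * hNum e g κ₀ κ₁ x} with hD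
  have hconv : Convex ℝ D := (ordConnected_hSignSet he g κ₀ κ₁ ς).convex
  have hcont : ContinuousOn (fun x => (ς : ℝ) * hRat e g κ₀ κ₁ x) D :=
    continuousOn_const.mul (continuousOn_hRat fun x hx => hx.2.1)
  have hder : ∀ x ∈ interior D, 0 < deriv (fun x => (ς : ℝ) * hRat e g κ₀ κ₁ x) x := by
    intro x hx
    have hxD : x ∈ D := interior_subset hx
    have hH : 0 < Polynomial.aeval x (hP e g) := hxD.2.1
    have hd := (hasDerivAt_hRat (κ₀ := κ₀) (κ₁ := κ₁) hH).const_mul (ς : ℝ)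
    rw [hd.deriv, ← mul_div_assoc]
    exact div_pos hxD.2.2 (mul_pos hH (vS_pos hH))
  have hmono : StrictMonoOn (fun x => (ς : ℝ) * hRat e g κ₀ κ₁ x) D :=
    strictMonoOn_of_deriv_pos hconv hcont hder
  intro x hx y hy hxy
  exact hmono.injOn hx hy (by show (ς : ℝ) * hRat e g κ₀ κ₁ x = ς * hRat e g κ₀ κ₁ y; rw [hxy])

/-! #### 51.2 The pullback of a section along a line edge -/

/-- **Line edge pullback.**  On a piece of an `R-HL` section over the line `y = λ(x)` on which `ς·N(ζ)/2 > 0`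
(`ς = ±1`) the chart representation `[T, γ·Hi(ζ)·g_m(v)]` is equivalent (rules (2)–(3),
`VertexChart.edge_pullback` with `v = V_m(λ(x)/√H(x))`) to the `x`-representation with the algebraic integrand
`ςγ·Hi(x)·√(H − mλ²)·(N/2)/H²` on a semialgebraic subset of `[0, 1]`; hence it lies in the Baker sector as soon
as the one-variable family `R-HLx` does (the semialgebraicity of the piece and of `ζ` is not even needed: the
parameter set and the pulled-back domain are cut out by the chart identities). [KontsevichZagier2001 §1.2
rules (2)–(3); this node] -/
theorem InBaker.of_Hline_piece
    (hX : (∀ (e g m γ k0 k1 : ℚ), 0 < e → 1 ≤ m →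
      ∀ (S : Set (Fin 1 → ℝ)), IsSemialgebraic ℚ S →
        (∀ t ∈ S, (0 ≤ t 0 ∧ t 0 ≤ 1) ∧ 0 < (e : ℝ) * t 0 ^ 2 + g ∧
          (m : ℝ) * ((k0 : ℝ) + k1 * t 0) ^ 2 < (e : ℝ) * t 0 ^ 2 + g) →
        ∀ r : KZ.IntegralRep 1, r.domain = S →
          EqOn r.integrand (fun t => (γ : ℝ) * ((e : ℝ) / 3 * t 0 ^ 3 + g * t 0) *
            √((e : ℝ) * t 0 ^ 2 + g - m * ((k0 : ℝ) + k1 * t 0) ^ 2) *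
            (((k1 : ℝ) * g - e * k0 * t 0) / ((e : ℝ) * t 0 ^ 2 + g) ^ 2)) S →
          InBaker (KZ.of r)))
    (he : 0 < e) (hm : 1 ≤ m) (γ : ℚ) {ς : ℚ} (hς : ς = 1 ∨ ς = -1)
    {T : Set (Fin 1 → ℝ)} {ζ : (Fin 1 → ℝ) → ℝ}
    (hF : ∀ b ∈ T, (0 < b 0 ∧ (m : ℝ) * b 0 ^ 2 < 1) ∧ (0 ≤ ζ b ∧ ζ b ≤ 1) ∧
      0 < Polynomial.aeval (ζ b) (hP e g) ∧ vS (hP e g) (ζ b) * gU m (b 0) = hLam κ₀ κ₁ (ζ b) ∧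
      0 < (ς : ℝ) * hNum e g κ₀ κ₁ (ζ b))
    (r : KZ.IntegralRep 1) (hrd : r.domain = T)
    (hri : EqOn r.integrand (fun b => (γ : ℝ) * ((e : ℝ) / 3 * ζ b ^ 3 + g * ζ b) * gW m (b 0)) T) :
    InBaker (KZ.of r) := by
  classical
  have hm0 : (0 : ℚ) ≤ m := zero_le_one.trans hm
  have he' : (0 : ℝ) < e := by exact_mod_cast he
  -- per-point facts on the section
  have hU : ∀ b ∈ T, gU m (b 0) = hRat e g κ₀ κ₁ (ζ b) := fun b hb => by
    have h := (hF b hb).2.2.2.1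
    have hS := vS_pos (hF b hb).2.2.1
    rw [hRat, eq_div_iff hS.ne', mul_comm]
    exact h
  have hV : ∀ b ∈ T, b 0 = gV m (hRat e g κ₀ κ₁ (ζ b)) := fun b hb => by
    rw [← hU b hb, gV_gU hm0 (hF b hb).1.2]
  have hρ : ∀ b ∈ T, (m : ℝ) * hRat e g κ₀ κ₁ (ζ b) ^ 2 < 1 := fun b hb => by
    rw [← hU b hb]; exact m_gU_sq_lt hm0 (hF b hb).1.2
  have hδ : ∀ b ∈ T, (m : ℝ) * hLam κ₀ κ₁ (ζ b) ^ 2 < Polynomial.aeval (ζ b) (hP e g) := fun b hb => by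
    have hA := (hF b hb).2.2.1
    have h := hρ b hb
    rw [hRat, div_pow, vS_sq hA.le, ← mul_div_assoc, div_lt_one hA] at h
    exact h
  -- the ratio bound on the parameter side
  have hρx : ∀ x : ℝ, 0 < Polynomial.aeval x (hP e g) →
      (m : ℝ) * hLam κ₀ κ₁ x ^ 2 < Polynomial.aeval x (hP e g) →
      (m : ℝ) * (hLam κ₀ κ₁ x / vS (hP e g) x) ^ 2 < 1 := fun x hA h => by
    rw [div_pow, vS_sq hA.le, ← mul_div_assoc, div_lt_one hA]
    exact h
  -- the parameter set `T₀ ⊆ [0, 1]`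
  set T₀ : Set (Fin 1 → ℝ) := {t | (0 ≤ t 0 ∧ t 0 ≤ 1) ∧ 0 < Polynomial.aeval (t 0) (hP e g) ∧
      (m : ℝ) * hLam κ₀ κ₁ (t 0) ^ 2 < Polynomial.aeval (t 0) (hP e g) ∧
      0 < (ς : ℝ) * hNum e g κ₀ κ₁ (t 0)} with hT₀def
  have hx1 : IsSemialgebraicFunOn ℚ (univ : Set (Fin 1 → ℝ)) fun t => t 0 :=
    (isSemialgebraicFunOn_aeval isSemialgebraic_univ (X 0 : MvPolynomial (Fin 1) ℚ)).congr
      fun t _ => by simp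
  have h1x : IsSemialgebraicFunOn ℚ (univ : Set (Fin 1 → ℝ)) fun t => 1 - t 0 :=
    (isSemialgebraicFunOn_aeval isSemialgebraic_univ (1 - X 0 : MvPolynomial (Fin 1) ℚ)).congr
      fun t _ => by simp
  have hA1 : IsSemialgebraicFunOn ℚ (univ : Set (Fin 1 → ℝ)) fun t => Polynomial.aeval (t 0) (hP e g) :=
    (isSemialgebraicFunOn_aeval isSemialgebraic_univ (C e * X 0 ^ 2 + C g : MvPolynomial (Fin 1) ℚ)).congr
      fun t _ => by
        simp only [map_add, map_mul, map_pow, MvPolynomial.aeval_C, MvPolynomial.aeval_X, eq_ratCast,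
          aeval_hP]
  have hL1 : IsSemialgebraicFunOn ℚ (univ : Set (Fin 1 → ℝ)) fun t => hLam κ₀ κ₁ (t 0) :=
    (isSemialgebraicFunOn_aeval isSemialgebraic_univ (C κ₀ + C κ₁ * X 0 : MvPolynomial (Fin 1) ℚ)).congr
      fun t _ => by
        simp only [map_add, map_mul, MvPolynomial.aeval_C, MvPolynomial.aeval_X, eq_ratCast, hLam]
  have hN1 : IsSemialgebraicFunOn ℚ (univ : Set (Fin 1 → ℝ)) fun t => (ς : ℝ) * hNum e g κ₀ κ₁ (t 0) :=
    (isSemialgebraicFunOn_aeval isSemialgebraic_univ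
      (C ς * (C κ₁ * C g - C e * C κ₀ * X 0) : MvPolynomial (Fin 1) ℚ)).congr fun t _ => by
        simp only [map_mul, map_sub, MvPolynomial.aeval_C, MvPolynomial.aeval_X, eq_ratCast, hNum]
  have hδ1 : IsSemialgebraicFunOn ℚ (univ : Set (Fin 1 → ℝ))
      fun t => Polynomial.aeval (t 0) (hP e g) - (m : ℝ) * hLam κ₀ κ₁ (t 0) ^ 2 :=
    (isSemialgebraicFunOn_aeval isSemialgebraic_univ
      (C e * X 0 ^ 2 + C g - C m * (C κ₀ + C κ₁ * X 0) ^ 2 : MvPolynomial (Fin 1) ℚ)).congr fun t _ => by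
        simp only [map_sub, map_add, map_mul, map_pow, MvPolynomial.aeval_C, MvPolynomial.aeval_X,
          eq_ratCast, aeval_hP, hLam]
  have hT₀ : IsSemialgebraic ℚ T₀ := by
    have h := (hx1.isSemialgebraic_sep_nonneg.inter h1x.isSemialgebraic_sep_nonneg).inter
      ((IsSemialgebraicFunOn.isSemialgebraic_sep_pos hA1).inter
        ((IsSemialgebraicFunOn.isSemialgebraic_sep_pos hδ1).inter
          (IsSemialgebraicFunOn.isSemialgebraic_sep_pos hN1)))
    convert h using 1
    ext t
    simp only [hT₀def, mem_setOf_eq, mem_inter_iff, mem_univ, true_and, sub_nonneg, sub_pos]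
  have hT₀sub : ∀ t ∈ T₀, t 0 ∈ {x : ℝ | 0 ≤ x ∧ 0 < Polynomial.aeval x (hP e g) ∧
      0 < (ς : ℝ) * hNum e g κ₀ κ₁ x} := fun t ht => ⟨ht.1.1, ht.2.1, ht.2.2.2⟩
  have hTsub : ∀ b ∈ T, ζ b ∈ {x : ℝ | 0 ≤ x ∧ 0 < Polynomial.aeval x (hP e g) ∧
      0 < (ς : ℝ) * hNum e g κ₀ κ₁ x} := fun b hb => ⟨(hF b hb).2.1.1, (hF b hb).2.2.1, (hF b hb).2.2.2.2⟩
  -- hypotheses of the edge pullback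
  have hybs : IsSemialgebraicFunOn ℚ T₀ fun t => hLam κ₀ κ₁ (t 0) := hL1.mono (subset_univ _) hT₀
  have hyb : ∀ t ∈ T₀, HasDerivAt (hLam κ₀ κ₁) ((fun _ : ℝ => (κ₁ : ℝ)) (t 0)) (t 0) := fun t _ =>
    hasDerivAt_hLam κ₀ κ₁ (t 0)
  have hH : ∀ t ∈ T₀, 0 < Polynomial.aeval (t 0) (hP e g) := fun t ht => ht.2.1
  have hrx : ∀ t ∈ T₀, (m : ℝ) *
      ((hLam κ₀ κ₁ (t 0) - Polynomial.aeval (t 0) (0 : Polynomial ℚ)) / vS (hP e g) (t 0)) ^ 2 < 1 :=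
    fun t ht => by
      rw [map_zero, sub_zero]
      exact hρx (t 0) ht.2.1 ht.2.2.1
  have hinj : ∀ s ∈ T₀, ∀ t ∈ T₀,
      (hLam κ₀ κ₁ (s 0) - Polynomial.aeval (s 0) (0 : Polynomial ℚ)) / vS (hP e g) (s 0) =
        (hLam κ₀ κ₁ (t 0) - Polynomial.aeval (t 0) (0 : Polynomial ℚ)) / vS (hP e g) (t 0) → s 0 = t 0 :=
    fun s hs t ht hst => by
      rw [map_zero, sub_zero, map_zero, sub_zero] at hst
      exact hRat_injOn he (hT₀sub s hs) (hT₀sub t ht) hst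
  have hsurj : ∀ w ∈ r.domain, ∃ t ∈ T₀,
      gV m ((hLam κ₀ κ₁ (t 0) - Polynomial.aeval (t 0) (0 : Polynomial ℚ)) / vS (hP e g) (t 0)) = w 0 :=
    fun w hw => by
      have hwT : w ∈ T := hrd ▸ hw
      refine ⟨fun _ => ζ w, ⟨(hF w hwT).2.1, (hF w hwT).2.2.1, hδ w hwT, (hF w hwT).2.2.2.2⟩, ?_⟩
      rw [map_zero, sub_zero]
      exact (hV w hwT).symm
  have hRe : ∀ t ∈ T₀,
      lift₁ (fun x => gV m ((hLam κ₀ κ₁ x - Polynomial.aeval x (0 : Polynomial ℚ)) / vS (hP e g) x)) t ∈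
          r.domain →
        r.integrand (lift₁ (fun x => gV m ((hLam κ₀ κ₁ x - Polynomial.aeval x (0 : Polynomial ℚ)) /
            vS (hP e g) x)) t) =
          vF m (hPi e g) γ (t 0)
            (gV m ((hLam κ₀ κ₁ (t 0) - Polynomial.aeval (t 0) (0 : Polynomial ℚ)) / vS (hP e g) (t 0))) :=
    fun t ht hb => by
      have hlift : lift₁ (fun x => gV m ((hLam κ₀ κ₁ x - Polynomial.aeval x (0 : Polynomial ℚ)) /
          vS (hP e g) x)) t = fun _ => gV m (hLam κ₀ κ₁ (t 0) / vS (hP e g) (t 0)) := by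
        funext i
        simp only [lift₁, map_zero, sub_zero]
      rw [hlift] at hb ⊢
      rw [map_zero, sub_zero]
      have hbT : (fun _ : Fin 1 => gV m (hLam κ₀ κ₁ (t 0) / vS (hP e g) (t 0))) ∈ T := hrd ▸ hb
      have hρt : (m : ℝ) * (hLam κ₀ κ₁ (t 0) / vS (hP e g) (t 0)) ^ 2 ≤ 1 :=
        (hρx (t 0) ht.2.1 ht.2.2.1).le
      have h := hU _ hbT
      rw [gU_gV hρt] at h
      have hζb : ζ (fun _ : Fin 1 => gV m (hLam κ₀ κ₁ (t 0) / vS (hP e g) (t 0))) = t 0 :=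
        hRat_injOn he (hTsub _ hbT) (hT₀sub t ht) h.symm
      rw [hri hbT]
      dsimp only
      rw [hζb, vF, aeval_hPi]
  -- the pulled-back integrand
  have hq0 : ∀ t ∈ T₀, MvPolynomial.aeval t ((C e * X 0 ^ 2 + C g) ^ 2 : MvPolynomial (Fin 1) ℚ) ≠ 0 :=
    fun t ht => by
      have h := ht.2.1
      rw [aeval_hP] at h
      simp only [map_pow, map_add, map_mul, MvPolynomial.aeval_C, MvPolynomial.aeval_X, eq_ratCast]
      exact pow_ne_zero 2 h.ne'
  have hcR : IsSemialgebraicFunOn ℚ T₀ fun _ => ((ς * γ : ℚ) : ℝ) := isSemialgebraicFunOn_ratCast hT₀ (ς * γ)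
  have hHi : IsSemialgebraicFunOn ℚ T₀ fun t => (e : ℝ) / 3 * t 0 ^ 3 + g * t 0 :=
    (isSemialgebraicFunOn_aeval hT₀ (C (e / 3) * X 0 ^ 3 + C g * X 0 : MvPolynomial (Fin 1) ℚ)).congr
      fun t _ => by
        simp only [map_add, map_mul, map_pow, MvPolynomial.aeval_C, MvPolynomial.aeval_X, eq_ratCast]
        push_cast
        ring
  have hsq : IsSemialgebraicFunOn ℚ T₀
      fun t => √((e : ℝ) * t 0 ^ 2 + g - m * ((κ₀ : ℝ) + κ₁ * t 0) ^ 2) :=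
    (IsSemialgebraicFunOn.sqrt_holds (isSemialgebraicFunOn_aeval hT₀
      (C e * X 0 ^ 2 + C g - C m * (C κ₀ + C κ₁ * X 0) ^ 2 : MvPolynomial (Fin 1) ℚ))).congr fun t _ => by
        simp only [map_sub, map_add, map_mul, map_pow, MvPolynomial.aeval_C, MvPolynomial.aeval_X,
          eq_ratCast]
  have hqq : IsSemialgebraicFunOn ℚ T₀
      fun t => ((κ₁ : ℝ) * g - e * κ₀ * t 0) / ((e : ℝ) * t 0 ^ 2 + g) ^ 2 :=
    (isSemialgebraicFunOn_aeval_div_aeval hT₀ (C κ₁ * C g - C e * C κ₀ * X 0 : MvPolynomial (Fin 1) ℚ)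
      ((C e * X 0 ^ 2 + C g) ^ 2) hq0).congr fun t _ => by
        simp only [map_sub, map_add, map_mul, map_pow, MvPolynomial.aeval_C, MvPolynomial.aeval_X,
          eq_ratCast]
  have hR : IsSemialgebraicFunOn ℚ T₀ fun t => ((ς * γ : ℚ) : ℝ) * ((e : ℝ) / 3 * t 0 ^ 3 + g * t 0) *
      √((e : ℝ) * t 0 ^ 2 + g - m * ((κ₀ : ℝ) + κ₁ * t 0) ^ 2) *
      (((κ₁ : ℝ) * g - e * κ₀ * t 0) / ((e : ℝ) * t 0 ^ 2 + g) ^ 2) :=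
    ((hcR.mul_holds hHi).mul_holds hsq).mul_holds hqq
  have hRE : ∀ t ∈ T₀,
      (fun t : Fin 1 → ℝ => ((ς * γ : ℚ) : ℝ) * ((e : ℝ) / 3 * t 0 ^ 3 + g * t 0) *
        √((e : ℝ) * t 0 ^ 2 + g - m * ((κ₀ : ℝ) + κ₁ * t 0) ^ 2) *
        (((κ₁ : ℝ) * g - e * κ₀ * t 0) / ((e : ℝ) * t 0 ^ 2 + g) ^ 2)) t =
      (γ : ℝ) * Polynomial.aeval (t 0) (hPi e g) *
        (vS (hP e g) (t 0) *
          gT m (gV m ((hLam κ₀ κ₁ (t 0) - Polynomial.aeval (t 0) (0 : Polynomial ℚ)) / vS (hP e g) (t 0)))) *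
        (|2 * Polynomial.aeval (t 0) (hP e g) *
              ((fun _ : ℝ => (κ₁ : ℝ)) (t 0) - Polynomial.aeval (t 0) (Polynomial.derivative (0 : Polynomial ℚ))) -
            (hLam κ₀ κ₁ (t 0) - Polynomial.aeval (t 0) (0 : Polynomial ℚ)) *
              Polynomial.aeval (t 0) (Polynomial.derivative (hP e g))| /
          (2 * Polynomial.aeval (t 0) (hP e g) ^ 2)) := fun t ht => by
    obtain ⟨-, hA, hδ', hNς⟩ := ht
    have hS := vS_pos hA
    have hρt : (m : ℝ) * (hLam κ₀ κ₁ (t 0) / vS (hP e g) (t 0)) ^ 2 ≤ 1 := (hρx (t 0) hA hδ').le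
    simp only [map_zero, sub_zero]
    have hTt : vS (hP e g) (t 0) * gT m (gV m (hLam κ₀ κ₁ (t 0) / vS (hP e g) (t 0))) =
        √((e : ℝ) * t 0 ^ 2 + g - m * ((κ₀ : ℝ) + κ₁ * t 0) ^ 2) := by
      rw [vS_mul_gT hm0 hA.le ((m_gV_sq_le hm0 _).trans hρt), gU_gV hρt, mul_div_assoc',
        mul_div_cancel_left₀ _ hS.ne', aeval_hP, hLam]
    have hnum : 2 * Polynomial.aeval (t 0) (hP e g) * (κ₁ : ℝ) -
        hLam κ₀ κ₁ (t 0) * Polynomial.aeval (t 0) (Polynomial.derivative (hP e g)) =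
        2 * hNum e g κ₀ κ₁ (t 0) := by
      rw [aeval_derivative_hP, aeval_hP]
      unfold hLam hNum
      ring
    have habs : |2 * hNum e g κ₀ κ₁ (t 0)| = 2 * ((ς : ℝ) * hNum e g κ₀ κ₁ (t 0)) := by
      rcases hς with rfl | rfl
      · rw [Rat.cast_one, one_mul] at hNς ⊢
        exact abs_of_pos (by linarith)
      · rw [Rat.cast_neg, Rat.cast_one] at hNς ⊢
        rw [abs_of_neg (by linarith)]
        ring
    rw [hTt, hnum, habs, aeval_hPi, aeval_hP]
    have hA' : (e : ℝ) * t 0 ^ 2 + g ≠ 0 := by rw [aeval_hP] at hA; exact hA.ne'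
    unfold hNum
    push_cast
    field_simp
  -- pull back
  obtain ⟨r₀, hd₀, hi₀, hrel⟩ := edge_pullback (Y₀ := 0) (yb' := fun _ : ℝ => (κ₁ : ℝ)) hm0 (hPi e g) γ r hT₀
    hybs hyb hH hrx hinj hsurj hRe _ hR hRE
  have h₀ : InBaker (KZ.of r₀) := by
    refine hX e g m (ς * γ) κ₀ κ₁ he hm r₀.domain r₀.isSemialgebraic_domain (fun t ht => ?_) r₀ rfl
      (fun t _ => by rw [hi₀])
    rw [hd₀] at ht
    obtain ⟨⟨h01, hA, hδ', -⟩, -⟩ := ht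
    rw [aeval_hP] at hA hδ'
    exact ⟨h01, hA, hδ'⟩
  have hrel' := KZ.relations.neg_mem hrel
  rw [neg_sub] at hrel'
  exact InBaker.congr h₀ hrel'

end Summit.KontsevichZagierPeriods.RootDecompWalshStrata.ConicDescent.BallCube
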